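import Summits.AtomisticToContinuum.BoseEinsteinCondensation.Theorems.BECCellInformationCoarseChainRule
import Summits.AtomisticToContinuum.BoseEinsteinCondensation.Theorems.BECCellInformationTwoScaleReductionChainRule

/-!
# Route `BECCellInformation` — the target implies the crux:
# `CondEntropyBound → CellInformationBound` (stmt-AtomisticToContinuum-13439 is NECESSARY for 13438)

Support file (`--supports stmt-AtomisticToContinuum-13439`) for the crux
`Summit.AtomisticToContinuum.BoseEinsteinCondensation.Theses.BECCellInformation.CellInformationBound`.

The route `BECCellInformation` reaches its target `CondEntropyBound` (bounded mean conditional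
relative entropy `E_Y KL(p(·|Y) ‖ u_Λ) ≤ C`) from the crux `CellInformationBound` (bounded coarse
mutual information `I(cell_l(x₁); Y) ≤ C`) and the (proved) `OneBodyEntropyBound` through the landed
`CoarseChainRule` and `TwoScaleReduction`. Here we prove the CONVERSE bookkeeping, with no physics:

  `CondEntropyBound → CellInformationBound`      (`cellInformationBound_of_condEntropyBound`),

for EVERY cell side (we take `l = 1`). Together with the landed direction this certifies in the kernel
that the route's split is lossless on the crux side: given the proved items, the target (13438) and
the crux (13439) are EQUIVALENT — the crux is on every path to the target.

Proof (data processing, two steps, fixed `N = n+1`, `L`, `M`, trial state `Ψ`, all in `[0, ∞]`):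
* (coarse ≤ fine, per bath configuration `Y`) `Σ_k (m/M³) klFun(M³A_k/m) ≤ ∫_Λ (m/L³) klFun(L³|Ψ(x,Y)|²/m) dx`
  — the log-sum inequality on each cell of side `L/M` for the density `|Ψ(·,Y)|²/m(Y)`
  (`CoarseChainRule.sum_inv_mul_klFun_le_setIntegral`), i.e. `KL(Q(·|Y) ‖ ū) ≤ KL(p(·|Y) ‖ u_Λ)`;
* (mutual information ≤ coarse conditional entropy, after `∫ dY`)
  `∫ Σ_k m P_k klFun(A_k/(m P_k)) ≤ ∫ Σ_k (m/M³) klFun(M³ A_k/m)` — pointwise the two integrands differ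
  by the signed term `Σ_k A_k log(M³ P_k)` (`CoarseChainRule.sum_klFun_coarse_eq`), whose `dY`-integral is
  `Σ_k P_k log(M³ P_k) = KL(P ‖ ū) ≥ 0` (Gibbs); the cancellation is done in `ℝ≥0∞` by splitting that
  term into its two nonnegative parts, so no integrability of the entropy integrands is needed.

References: Cover–Thomas, *Elements of Information Theory*, Thm 2.5.3 (chain rule), Thm 2.6.3
(Gibbs' inequality), Thm 2.7.1 (log-sum inequality) — elementary, reproved over Mathlib's `klFun`.
-/

noncomputable section

namespace Summit.AtomisticToContinuum.BoseEinsteinCondensation.Theorems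

open MeasureTheory Set InformationTheory
open scoped ENNReal
open Literature.MathematicalPhysics.QuantumManyBody.BoseGas

namespace CellInformationBound.OfCondEntropy

open CoarseChainRule

/-! ### Finite-alphabet bookkeeping -/

/-- **Gibbs' inequality on a finite alphabet**, junk-free form: for a probability vector `P` on an
alphabet of size `K`, `0 ≤ Σ_k P_k log(K P_k)` (`= KL(P ‖ uniform) = Σ_k K⁻¹ klFun(K P_k)`).
[cite: CoverThomas2005, Thm 2.6.3] -/
theorem sum_mul_log_mul_nonneg {ι : Type*} [Fintype ι] {K : ℝ} (hK : (Fintype.card ι : ℝ) = K)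
    (hKpos : 0 < K) {P : ι → ℝ} (hP : ∀ k, 0 ≤ P k) (hsumP : ∑ k, P k = 1) :
    0 ≤ ∑ k, P k * Real.log (K * P k) := by
  have hKne : K ≠ 0 := hKpos.ne'
  have hpt : ∀ k, K⁻¹ * klFun (K * P k) = P k * Real.log (K * P k) + (K⁻¹ - P k) := by
    intro k
    rw [klFun_apply]
    field_simp
    ring
  have h : ∑ k, K⁻¹ * klFun (K * P k) = ∑ k, P k * Real.log (K * P k) := by
    simp only [hpt, Finset.sum_add_distrib, Finset.sum_sub_distrib, Finset.sum_const,
      Finset.card_univ, nsmul_eq_mul, hK, hsumP, mul_inv_cancel₀ hKne, sub_self, add_zero]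
  rw [← h]
  exact Finset.sum_nonneg fun k _ =>
    mul_nonneg (inv_nonneg.2 hKpos.le) (klFun_nonneg (mul_nonneg hKpos.le (hP k)))

/-- `max a 0 = a + max (-a) 0`. [folklore] -/
theorem max_zero_eq_add_max_neg_zero (a : ℝ) : max a 0 = a + max (-a) 0 := by
  have h := max_zero_sub_max_neg_zero_eq_self a
  linarith

/-! ### Abstract step: mutual information ≤ coarse conditional entropy -/

/-- **Mutual information is at most the coarse conditional entropy** (abstract form). On a measure
space let `A_k ≥ 0` be integrable with `Σ_k A_k = m` a.e. and `P_k = ∫ A_k` a probability vector on an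
alphabet of size `K`. Then
`∫⁻ ofReal(Σ_k m P_k klFun(A_k/(m P_k))) ≤ ∫⁻ ofReal(Σ_k (m/K) klFun(K A_k/m))`, i.e.
`I(K;Y) = E_Y KL(Q(·|Y) ‖ P) ≤ E_Y KL(Q(·|Y) ‖ uniform)` (the difference is `KL(P ‖ uniform) ≥ 0`).
[cite: CoverThomas2005, Thm 2.5.3 and Thm 2.6.3] -/
theorem lintegral_ofReal_sum_mi_le_coarse {α : Type*} [MeasurableSpace α] {μ : Measure α}
    {ι : Type*} [Fintype ι] {K : ℝ} (hK : (Fintype.card ι : ℝ) = K) (hKpos : 0 < K)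
    {m : α → ℝ} {A : ι → α → ℝ} {P : ι → ℝ}
    (hA0 : ∀ k Y, 0 ≤ A k Y) (hAi : ∀ k, Integrable (A k) μ) (hP : ∀ k, P k = ∫ Y, A k Y ∂μ)
    (hsumA : ∀ᵐ Y ∂μ, ∑ k, A k Y = m Y) (hsumP : ∑ k, P k = 1) :
    ∫⁻ Y, ENNReal.ofReal (∑ k, m Y * P k * klFun (A k Y / (m Y * P k))) ∂μ ≤
      ∫⁻ Y, ENNReal.ofReal (∑ k, m Y / K * klFun (K * A k Y / m Y)) ∂μ := by
  have hP0 : ∀ k, 0 ≤ P k := fun k => by rw [hP k]; exact integral_nonneg (hA0 k)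
  -- compatibility `P k = 0 → A k = 0`, almost everywhere
  have hcompat : ∀ᵐ Y ∂μ, ∀ k, P k = 0 → A k Y = 0 := by
    rw [ae_all_iff]
    intro k
    by_cases hk : P k = 0
    · have h := (integral_eq_zero_iff_of_nonneg (hA0 k) (hAi k)).1 ((hP k).symm.trans hk)
      filter_upwards [h] with Y hY _ using hY
    · exact ae_of_all _ fun Y h => absurd h hk
  -- the two nonnegative parts of the signed term `Σ_k A_k log (K P_k)`
  have hSp0 : ∀ Y, 0 ≤ ∑ k, A k Y * max (Real.log (K * P k)) 0 := fun Y =>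
    Finset.sum_nonneg fun k _ => mul_nonneg (hA0 k Y) (le_max_right _ _)
  have hSm0 : ∀ Y, 0 ≤ ∑ k, A k Y * max (-Real.log (K * P k)) 0 := fun Y =>
    Finset.sum_nonneg fun k _ => mul_nonneg (hA0 k Y) (le_max_right _ _)
  have hSpi : Integrable (fun Y => ∑ k, A k Y * max (Real.log (K * P k)) 0) μ :=
    integrable_finsetSum _ fun k _ => (hAi k).mul_const _
  have hSmi : Integrable (fun Y => ∑ k, A k Y * max (-Real.log (K * P k)) 0) μ :=
    integrable_finsetSum _ fun k _ => (hAi k).mul_const _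
  have hSp_int : ∫ Y, ∑ k, A k Y * max (Real.log (K * P k)) 0 ∂μ =
      ∑ k, P k * max (Real.log (K * P k)) 0 := by
    rw [integral_finsetSum _ fun k _ => (hAi k).mul_const _]
    refine Finset.sum_congr rfl fun k _ => ?_
    rw [integral_mul_const, hP k]
  have hSm_int : ∫ Y, ∑ k, A k Y * max (-Real.log (K * P k)) 0 ∂μ =
      ∑ k, P k * max (-Real.log (K * P k)) 0 := by
    rw [integral_finsetSum _ fun k _ => (hAi k).mul_const _]
    refine Finset.sum_congr rfl fun k _ => ?_
    rw [integral_mul_const, hP k]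
  -- Gibbs: the negative part integrates to less than the positive part
  have hGibbs : ∑ k, P k * max (-Real.log (K * P k)) 0 ≤ ∑ k, P k * max (Real.log (K * P k)) 0 := by
    have h := sum_mul_log_mul_nonneg hK hKpos hP0 hsumP
    have e : ∑ k, P k * max (Real.log (K * P k)) 0 =
        ∑ k, P k * Real.log (K * P k) + ∑ k, P k * max (-Real.log (K * P k)) 0 := by
      rw [← Finset.sum_add_distrib]
      refine Finset.sum_congr rfl fun k _ => ?_
      rw [← mul_add, ← max_zero_eq_add_max_neg_zero]
    linarith
  -- the pointwise (a.e.) identity `MI + S⁺ = coarse + S⁻` in `ℝ≥0∞`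
  have hpt : ∀ᵐ Y ∂μ,
      ENNReal.ofReal (∑ k, m Y * P k * klFun (A k Y / (m Y * P k))) +
          ENNReal.ofReal (∑ k, A k Y * max (Real.log (K * P k)) 0) =
        ENNReal.ofReal (∑ k, m Y / K * klFun (K * A k Y / m Y)) +
          ENNReal.ofReal (∑ k, A k Y * max (-Real.log (K * P k)) 0) := by
    filter_upwards [hsumA, hcompat] with Y hsum hcomp
    have hm0 : 0 ≤ m Y := hsum ▸ Finset.sum_nonneg fun k _ => hA0 k Y
    have hMI0 : 0 ≤ ∑ k, m Y * P k * klFun (A k Y / (m Y * P k)) :=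
      Finset.sum_nonneg fun k _ => mul_nonneg (mul_nonneg hm0 (hP0 k))
        (klFun_nonneg (div_nonneg (hA0 k Y) (mul_nonneg hm0 (hP0 k))))
    have hC0 : 0 ≤ ∑ k, m Y / K * klFun (K * A k Y / m Y) :=
      Finset.sum_nonneg fun k _ => mul_nonneg (div_nonneg hm0 hKpos.le)
        (klFun_nonneg (div_nonneg (mul_nonneg hKpos.le (hA0 k Y)) hm0))
    have eS : ∑ k, A k Y * max (Real.log (K * P k)) 0 =
        ∑ k, A k Y * Real.log (K * P k) + ∑ k, A k Y * max (-Real.log (K * P k)) 0 := by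
      rw [← Finset.sum_add_distrib]
      refine Finset.sum_congr rfl fun k _ => ?_
      rw [← mul_add, ← max_zero_eq_add_max_neg_zero]
    rw [← ENNReal.ofReal_add hMI0 (hSp0 Y), ← ENNReal.ofReal_add hC0 (hSm0 Y),
      sum_klFun_coarse_eq hK hKpos (fun k => hA0 k Y) hP0 hsum hsumP hcomp, eS]
    congr 1
    ring
  -- integrate the identity
  have hSp_lint : ∫⁻ Y, ENNReal.ofReal (∑ k, A k Y * max (Real.log (K * P k)) 0) ∂μ =
      ENNReal.ofReal (∑ k, P k * max (Real.log (K * P k)) 0) := by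
    rw [← hSp_int, ofReal_integral_eq_lintegral_ofReal hSpi (ae_of_all _ hSp0)]
  have hSm_lint : ∫⁻ Y, ENNReal.ofReal (∑ k, A k Y * max (-Real.log (K * P k)) 0) ∂μ =
      ENNReal.ofReal (∑ k, P k * max (-Real.log (K * P k)) 0) := by
    rw [← hSm_int, ofReal_integral_eq_lintegral_ofReal hSmi (ae_of_all _ hSm0)]
  have key : ∫⁻ Y, ENNReal.ofReal (∑ k, m Y * P k * klFun (A k Y / (m Y * P k))) ∂μ +
        ∫⁻ Y, ENNReal.ofReal (∑ k, A k Y * max (Real.log (K * P k)) 0) ∂μ =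
      ∫⁻ Y, ENNReal.ofReal (∑ k, m Y / K * klFun (K * A k Y / m Y)) ∂μ +
        ∫⁻ Y, ENNReal.ofReal (∑ k, A k Y * max (-Real.log (K * P k)) 0) ∂μ := by
    rw [← lintegral_add_right' _ hSpi.aestronglyMeasurable.aemeasurable.ennreal_ofReal,
      ← lintegral_add_right' _ hSmi.aestronglyMeasurable.aemeasurable.ennreal_ofReal]
    exact lintegral_congr_ae hpt
  have hfin : ∫⁻ Y, ENNReal.ofReal (∑ k, A k Y * max (Real.log (K * P k)) 0) ∂μ ≠ ⊤ := by
    rw [hSp_lint]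
    exact ENNReal.ofReal_ne_top
  have hle : ∫⁻ Y, ENNReal.ofReal (∑ k, A k Y * max (-Real.log (K * P k)) 0) ∂μ ≤
      ∫⁻ Y, ENNReal.ofReal (∑ k, A k Y * max (Real.log (K * P k)) 0) ∂μ := by
    rw [hSp_lint, hSm_lint]
    exact ENNReal.ofReal_le_ofReal hGibbs
  refine (ENNReal.add_le_add_iff_right hfin).1 ?_
  rw [key]
  exact add_le_add le_rfl hle

/-! ### Coarse ≤ fine at a fixed bath configuration (log-sum inequality per cell) -/

/-- **Coarse-graining decreases relative entropy** (data processing at fixed `Y`). For a continuous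
`f : ℝ³ → ℂ` vanishing off the open box `Λ_L`, with `φ = |f|²`, `m = ∫ φ` and cells of side `L/M`
(`M ≥ 1`) with masses `A_q = ∫_{cell q} φ`:
`ofReal(Σ_q (m/M³) klFun(M³ A_q/m)) ≤ ∫⁻_{Λ_L} ofReal((m/L³) klFun(L³ φ/m))`, i.e.
`m · KL(Q ‖ ū) ≤ m · KL(p ‖ u_Λ)` for `p = φ/m`, `Q(q) = A_q/m`. [cite: CoverThomas2005, Thm 2.7.1] -/
theorem ofReal_sum_coarse_le_lintegral_fine {L : ℝ} (hL : 0 < L) {M : ℕ} (hM : 0 < M)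
    {f : Space → ℂ} (hf : Continuous f) (hsupp : ∀ x, x ∉ box L → f x = 0) :
    ENNReal.ofReal (∑ q : Fin 3 → Fin M, (∫ z, ‖f z‖ ^ 2) / (M : ℝ) ^ 3 *
        klFun ((M : ℝ) ^ 3 * (∫ x in {y : Space | ∀ j, y j ∈
          Set.Ico (((q j : ℕ) : ℝ) * (L / (M : ℝ))) ((((q j : ℕ) : ℝ) + 1) * (L / (M : ℝ)))},
          ‖f x‖ ^ 2) / ∫ z, ‖f z‖ ^ 2)) ≤
      ∫⁻ x in box L, ENNReal.ofReal ((∫ z, ‖f z‖ ^ 2) / L ^ 3 *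
        klFun (L ^ 3 * ‖f x‖ ^ 2 / ∫ z, ‖f z‖ ^ 2)) := by
  have hMr : (0 : ℝ) < M := Nat.cast_pos.2 hM
  have hs : 0 < L / M := div_pos hL hMr
  have hKpos : 0 < (M : ℝ) ^ 3 := by positivity
  have hc : 0 < L ^ 3 := by positivity
  -- the cells
  let cell : (Fin 3 → Fin M) → Set Space := fun k => {y : Space | ∀ j, y j ∈
    Set.Ico (((k j : ℕ) : ℝ) * (L / (M : ℝ))) ((((k j : ℕ) : ℝ) + 1) * (L / (M : ℝ)))}
  have hcm : ∀ k, MeasurableSet (cell k) := fun k => measurableSet_cell (L / M) k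
  have hdisj : Pairwise (Function.onFun Disjoint cell) := pairwise_disjoint_cell hs M
  have hvol : ∀ k, volume.real (cell k) = L ^ 3 / (M : ℝ) ^ 3 := fun k => by
    rw [measureReal_def, show volume (cell k) = ENNReal.ofReal ((L / M) ^ 3) from
      volume_cell hs.le k, ENNReal.toReal_ofReal (by positivity), div_pow]
  have hUae : (⋃ k, cell k) =ᵐ[volume] box L := iUnion_cell_ae_eq_box hL hM
  -- compact closed box containing the open box and the cells
  have hK : IsCompact {y : Space | ∀ j, y j ∈ Icc (0 : ℝ) L} :=
    TwoScaleReduction.isCompact_IccCell (m := 3) (fun _ => 0) (fun _ => L)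
  have hboxK : box L ⊆ {y : Space | ∀ j, y j ∈ Icc (0 : ℝ) L} :=
    fun y hy j => Ioo_subset_Icc_self (hy j)
  have hcellK : (⋃ k, cell k) ⊆ {y : Space | ∀ j, y j ∈ Icc (0 : ℝ) L} :=
    Set.iUnion_subset fun k y hy j => Ico_subset_Icc_self (cell_subset_Ico hL.le k hy j)
  -- the density
  have hφc : Continuous fun x => ‖f x‖ ^ 2 := (hf.norm).pow 2
  have hφ0 : ∀ x, x ∉ box L → ‖f x‖ ^ 2 = 0 := fun x hx => by simp [hsupp x hx]
  have hφi : Integrable fun x => ‖f x‖ ^ 2 :=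
    hφc.integrable_of_hasCompactSupport
      (HasCompactSupport.intro hK fun x hx => hφ0 x fun hb => hx (hboxK hb))
  set m : ℝ := ∫ z, ‖f z‖ ^ 2 with hm_def
  have hm0 : 0 ≤ m := integral_nonneg fun x => sq_nonneg _
  rcases hm0.eq_or_lt with hm | hm
  · -- `m = 0`: the left-hand side vanishes
    rw [← hm]
    simp
  -- `m > 0`: log-sum inequality on each cell for `g = φ / m`
  let g : Space → ℝ := fun x => ‖f x‖ ^ 2 / m
  have hg0 : ∀ x, 0 ≤ g x := fun x => div_nonneg (sq_nonneg _) hm0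
  have hgi : Integrable g := hφi.div_const m
  have hFc : Continuous fun x => (L ^ 3)⁻¹ * klFun (L ^ 3 * g x) :=
    continuous_const.mul (continuous_klFun.comp (continuous_const.mul (hφc.div_const _)))
  have hF0 : ∀ x, 0 ≤ (L ^ 3)⁻¹ * klFun (L ^ 3 * g x) := fun x =>
    mul_nonneg (inv_nonneg.2 hc.le) (klFun_nonneg (mul_nonneg hc.le (hg0 x)))
  have hFK : IntegrableOn (fun x => (L ^ 3)⁻¹ * klFun (L ^ 3 * g x))
      {y : Space | ∀ j, y j ∈ Icc (0 : ℝ) L} := hFc.continuousOn.integrableOn_compact hK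
  have hIB : IntegrableOn (fun x => (L ^ 3)⁻¹ * klFun (L ^ 3 * g x)) (⋃ k, cell k) :=
    hFK.mono_set hcellK
  have hJ := sum_inv_mul_klFun_le_setIntegral hcm hdisj hKpos hc hvol hg0 hgi hIB
  -- rewrite both sides
  have hAg : ∀ k, (M : ℝ) ^ 3 * ∫ x in cell k, g x =
      (M : ℝ) ^ 3 * (∫ x in cell k, ‖f x‖ ^ 2) / m := fun k => by
    show (M : ℝ) ^ 3 * ∫ x in cell k, ‖f x‖ ^ 2 / m = _
    rw [integral_div, mul_div_assoc]
  have hlhs : ∑ q : Fin 3 → Fin M, m / (M : ℝ) ^ 3 *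
        klFun ((M : ℝ) ^ 3 * (∫ x in cell q, ‖f x‖ ^ 2) / m) =
      m * ∑ q : Fin 3 → Fin M, ((M : ℝ) ^ 3)⁻¹ * klFun ((M : ℝ) ^ 3 * ∫ x in cell q, g x) := by
    rw [Finset.mul_sum]
    refine Finset.sum_congr rfl fun q _ => ?_
    rw [hAg q, div_eq_mul_inv, mul_assoc]
  have hrhs_pt : ∀ x, m / L ^ 3 * klFun (L ^ 3 * ‖f x‖ ^ 2 / m) =
      m * ((L ^ 3)⁻¹ * klFun (L ^ 3 * g x)) := fun x => by
    show _ = m * ((L ^ 3)⁻¹ * klFun (L ^ 3 * (‖f x‖ ^ 2 / m)))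
    rw [← mul_div_assoc, div_eq_mul_inv m, mul_assoc]
  have hRint : IntegrableOn (fun x => m / L ^ 3 * klFun (L ^ 3 * ‖f x‖ ^ 2 / m)) (box L) := by
    have h1 : IntegrableOn (fun x => m * ((L ^ 3)⁻¹ * klFun (L ^ 3 * g x))) (box L) :=
      (hFK.mono_set hboxK).const_mul m
    exact h1.congr_fun (fun x _ => (hrhs_pt x).symm) (measurableSet_box L)
  have hR0 : ∀ x, 0 ≤ m / L ^ 3 * klFun (L ^ 3 * ‖f x‖ ^ 2 / m) := fun x =>
    mul_nonneg (div_nonneg hm0 hc.le) (klFun_nonneg (by positivity))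
  rw [← ofReal_integral_eq_lintegral_ofReal hRint (ae_of_all _ hR0)]
  refine ENNReal.ofReal_le_ofReal ?_
  calc ∑ q : Fin 3 → Fin M, m / (M : ℝ) ^ 3 * klFun ((M : ℝ) ^ 3 * (∫ x in cell q, ‖f x‖ ^ 2) / m)
      = m * ∑ q : Fin 3 → Fin M, ((M : ℝ) ^ 3)⁻¹ * klFun ((M : ℝ) ^ 3 * ∫ x in cell q, g x) := hlhs
    _ ≤ m * ∫ x in ⋃ k, cell k, (L ^ 3)⁻¹ * klFun (L ^ 3 * g x) :=
        mul_le_mul_of_nonneg_left hJ hm0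
    _ = m * ∫ x in box L, (L ^ 3)⁻¹ * klFun (L ^ 3 * g x) := by rw [setIntegral_congr_set hUae]
    _ = ∫ x in box L, m / L ^ 3 * klFun (L ^ 3 * ‖f x‖ ^ 2 / m) := by
        rw [← integral_const_mul]
        exact setIntegral_congr_fun (measurableSet_box L) fun x _ => (hrhs_pt x).symm

/-! ### The estimate for a trial state -/

/-- **Crux functional ≤ target functional (fixed `N = n+1`, `L > 0`, `M ≥ 1`, any trial state).**
The coarse mutual-information integrand of `CellInformationBound` at cell side `L/M` has
`∫⁻ dY` bounded by the conditional relative entropy functional of `CondEntropyBound`: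
`I(cell(x₁); Y) ≤ E_Y KL(Q(·|Y) ‖ ū) ≤ E_Y KL(p(·|Y) ‖ u_Λ)`. [cite: CoverThomas2005, Thm 2.5.3, 2.6.3, 2.7.1] -/
theorem lintegral_cellInformation_le_condEntropy {n : ℕ} {L : ℝ} (hL : 0 < L) {M : ℕ} (hM : 0 < M)
    (Ψ : TrialState (n + 1) L) :
    ∫⁻ Y : Config n, ENNReal.ofReal (∑ k : Fin 3 → Fin M,
      (∫ z, ‖Ψ.ψ (Matrix.vecCons z Y)‖ ^ 2) *
        (∫ Y' : Config n, ∫ x in {y : Space | ∀ j, y j ∈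
          Set.Ico (((k j : ℕ) : ℝ) * (L / (M : ℝ))) ((((k j : ℕ) : ℝ) + 1) * (L / (M : ℝ)))},
          ‖Ψ.ψ (Matrix.vecCons x Y')‖ ^ 2) *
        klFun ((∫ x in {y : Space | ∀ j, y j ∈
          Set.Ico (((k j : ℕ) : ℝ) * (L / (M : ℝ))) ((((k j : ℕ) : ℝ) + 1) * (L / (M : ℝ)))},
          ‖Ψ.ψ (Matrix.vecCons x Y)‖ ^ 2) /
          ((∫ z, ‖Ψ.ψ (Matrix.vecCons z Y)‖ ^ 2) *
            (∫ Y' : Config n, ∫ x in {y : Space | ∀ j, y j ∈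
              Set.Ico (((k j : ℕ) : ℝ) * (L / (M : ℝ))) ((((k j : ℕ) : ℝ) + 1) * (L / (M : ℝ)))},
              ‖Ψ.ψ (Matrix.vecCons x Y')‖ ^ 2)))) ≤
      ∫⁻ Y : Config n, ∫⁻ x in box L, ENNReal.ofReal ((∫ z, ‖Ψ.ψ (Matrix.vecCons z Y)‖ ^ 2) / L ^ 3 *
        klFun (L ^ 3 * ‖Ψ.ψ (Matrix.vecCons x Y)‖ ^ 2 / ∫ z, ‖Ψ.ψ (Matrix.vecCons z Y)‖ ^ 2)) := by
  have hMr : (0 : ℝ) < M := Nat.cast_pos.2 hM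
  have hKpos : 0 < (M : ℝ) ^ 3 := by positivity
  have hcard : (Fintype.card (Fin 3 → Fin M) : ℝ) = (M : ℝ) ^ 3 := by
    rw [Fintype.card_fun, Fintype.card_fin, Fintype.card_fin, Nat.cast_pow]
  -- the cells, cell masses, slice mass and cell law
  let cell : (Fin 3 → Fin M) → Set Space := fun k => {y : Space | ∀ j, y j ∈
    Set.Ico (((k j : ℕ) : ℝ) * (L / (M : ℝ))) ((((k j : ℕ) : ℝ) + 1) * (L / (M : ℝ)))}
  have hA0 : ∀ k (Y : Config n), 0 ≤ ∫ x in cell k, ‖Ψ.ψ (Matrix.vecCons x Y)‖ ^ 2 :=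
    fun k Y => integral_nonneg fun x => sq_nonneg _
  have hAi : ∀ k, Integrable (fun Y : Config n => ∫ x in cell k, ‖Ψ.ψ (Matrix.vecCons x Y)‖ ^ 2) :=
    fun k => integrable_setIntegral_normSq_vecCons Ψ (cell k)
  have hsumA : ∀ᵐ Y : Config n, ∑ k, ∫ x in cell k, ‖Ψ.ψ (Matrix.vecCons x Y)‖ ^ 2 =
      ∫ z, ‖Ψ.ψ (Matrix.vecCons z Y)‖ ^ 2 := ae_sum_setIntegral_cell_eq hL hM Ψ
  have hsumP : ∑ k, ∫ Y : Config n, ∫ x in cell k, ‖Ψ.ψ (Matrix.vecCons x Y)‖ ^ 2 = 1 := by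
    rw [← integral_finsetSum _ fun k _ => hAi k, integral_congr_ae hsumA]
    exact integral_integral_normSq_vecCons Ψ
  -- step 1: mutual information ≤ coarse conditional entropy
  have h1 := lintegral_ofReal_sum_mi_le_coarse (μ := volume) hcard hKpos
    (m := fun Y : Config n => ∫ z, ‖Ψ.ψ (Matrix.vecCons z Y)‖ ^ 2)
    (A := fun k (Y : Config n) => ∫ x in cell k, ‖Ψ.ψ (Matrix.vecCons x Y)‖ ^ 2)
    (P := fun k => ∫ Y : Config n, ∫ x in cell k, ‖Ψ.ψ (Matrix.vecCons x Y)‖ ^ 2)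
    hA0 hAi (fun k => rfl) hsumA hsumP
  refine h1.trans (lintegral_mono fun Y => ?_)
  -- step 2: coarse ≤ fine on the fibre `x ↦ Ψ(x :: Y)`
  have hfc : Continuous fun x : Space => Ψ.ψ (Matrix.vecCons x Y) :=
    Ψ.contDiff.continuous.comp (continuous_id.matrixVecCons continuous_const)
  have hf0 : ∀ x : Space, x ∉ box L → Ψ.ψ (Matrix.vecCons x Y) = 0 := fun x hx =>
    Ψ.eq_zero _ fun hX => hx (by simpa using hX 0)
  exact ofReal_sum_coarse_le_lintegral_fine hL hM hfc hf0

end CellInformationBound.OfCondEntropy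

namespace CellInformationBound

/-- **The target implies the crux: `CondEntropyBound → CellInformationBound`** (route
`BECCellInformation`; the crux stmt-AtomisticToContinuum-13439 is NECESSARY for the target
stmt-AtomisticToContinuum-13438, at every cell side — here `l = 1`). Pure information-theoretic
bookkeeping: `I(cell_l(x₁); Y) ≤ E_Y KL(Q_l(·|Y) ‖ ū_l) ≤ E_Y KL(p(·|Y) ‖ u_Λ)` for every trial
state (data processing under coarse-graining plus Gibbs' inequality), so the constant, `ρ₀` and `δ`
of `CondEntropyBound` work verbatim. With the landed `CoarseChainRule`, `TwoScaleReduction`,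
`EnergyPerParticleBound` and `OneBodyEntropyBound` this makes 13438 and 13439 equivalent in the tree.
[cite: CoverThomas2005, Thm 2.5.3, Thm 2.6.3, Thm 2.7.1] -/
theorem cellInformationBound_of_condEntropyBound : Summit.AtomisticToContinuum.BoseEinsteinCondensation.Theses.BECCellInformation.CondEntropyBound → Summit.AtomisticToContinuum.BoseEinsteinCondensation.Theses.BECCellInformation.CellInformationBound := by
  intro h v hv
  obtain ⟨ρ₀, hρ₀, H⟩ := h v hv
  refine ⟨ρ₀, hρ₀, fun ρ hρ hρlt => ?_⟩
  obtain ⟨C, hev⟩ := H ρ hρ hρlt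
  refine ⟨1, one_pos, C, ?_⟩
  filter_upwards [hev] with n hn
  obtain ⟨δ, hδ, hΨ⟩ := hn
  refine ⟨δ, hδ, fun Ψ hE hpos => ?_⟩
  have hL : 0 < sideLength ρ (n + 1) := by
    unfold sideLength
    exact Real.rpow_pos_of_pos (div_pos (Nat.cast_pos.2 n.succ_pos) hρ) _
  have hM : 0 < ⌈sideLength ρ (n + 1) / 1⌉₊ := Nat.ceil_pos.2 (div_pos hL one_pos)
  exact (OfCondEntropy.lintegral_cellInformation_le_condEntropy hL hM Ψ).trans (hΨ Ψ hE hpos)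

end CellInformationBound

end Summit.AtomisticToContinuum.BoseEinsteinCondensation.Theorems

end
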